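import Mathlib
import Summits.NavierStokesRegularity.NavierStokesRegularity.Theorems.EulerZoomLiouvillePowerGaugeEulerLiouvilleDSSEnergySaturation
import Summits.NavierStokesRegularity.NavierStokesRegularity.Theorems.EulerZoomLiouvillePowerGaugeEulerLiouvilleSelfSimilarOffRateTools
import Summits.NavierStokesRegularity.NavierStokesRegularity.Theorems.EulerZoomLiouvillePowerGaugeEulerLiouvilleBackwardTools
import HarnessLib

/-!
# OFF-RATE CLASSICAL DSS MEMBERS IN THE WINDOW ARE TRIVIAL: a classical discretely self-similar member of Seregin's `ρ`-class at a rate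
# `g ∈ (1/(2+ρ), ½)` — `u(τ, y) = T^{1−g} u(Tτ, T^{g} y)`, one factor `T > 1` — with the Bernoulli shell bound vanishes; NO sub-extremality hypothesis
# (crux `EulerZoomLiouville.PowerGaugeEulerLiouville` = stmt-NavierStokesRegularity-19832; strata `IsDiscreteClock` / `IsDSSClassicalEnergy` of `birth`)

Route `EulerZoomLiouville` (NavierStokesRegularity); width seat ns-ezl-w6 (cell ns-regularity-ideate, LEAD ns-typeII-p2).  The DISCRETE twin of ns-ezl-w4's
RATE RIGIDITY (`OffRate.selfSimilar_ae_eq_zero_of_rate_window`): ns-ezl-w4's `…DiscreteClock` kills discrete clocks at FAST (`g > ½ − ρ/5`) and SLOW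
(`g < 1/(2+ρ)`) rates by the `A`-gauge alone, and ns-typeII-p3's `CollapseEnergy.eq_zero_of_dss_subExtremal` kills CLASSICAL class-rate DSS members with
the Bernoulli shell bound that are SUB-EXTREMAL at one time.  Read a discrete clock of rate `g` in the window `1/(2+ρ) < g < ½` as a class-`ρ'` DSS member of
the FICTITIOUS class `ρ' = 1/g − 2 ∈ (0, ρ)` (factor `l = T^{g}`: `T^{1−g} = l^{1+ρ'}`, `T = l^{2+ρ'}`): its sub-extremality in the `ρ'`-normalisation at the
time `τ₀ = −1` is AUTOMATIC from the `ρ`-class `A`-gauge — `R^{2ρ'−1}∫_{B_R}|u(−1)|² ≤ c R^{2(ρ'−ρ)} → 0` — so `eq_zero_of_dss_subExtremal (ρ := ρ')` applies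
with no sub-extremality hypothesis.

* `OffRateDSS.dss_of_discreteClock` — the rate-`g` discrete clock is `l`-DSS for the class-`ρ'` scaling, `l = T^g`;
* `OffRateDSS.subExtremal_fictitious_of_gaugeA` — the `ρ`-class `A`-gauge makes every slice sub-extremal in the `ρ'`-normalisation (`ρ' < ρ`);
* `OffRateDSS.ae_eq_zero_of_gauge_of_classical_dss_ownRate_subExtremal`, `OffRateDSS.dss_ownRate_energy_saturation` (appended) — the SLOW discrete window
  `g ∈ [2/5, 1/(2+ρ))` in census form: own-rate sub-extremal ⇒ trivial; nontrivial ⇒ `∫_{B_R}|u(τ₀)|² ≥ c₁R^{5−2/g}` at every time;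
* `OffRateDSS.ae_eq_zero_of_gauge_of_classical_dss_window` — MEMBER LEVEL: crux hypotheses verbatim (`0 < ρ ≤ ½`) + classical on the open past + discrete
  clock at a rate `g ∈ (1/(2+ρ), ½)` + Bernoulli shell bound `∫_{R≤|y|≤2R}(|u|³+2|p||u|) ≤ K R^β` (`β < 1`, `R ≥ R₀(−τ)^{γ'}`) ⇒ `u = 0` a.e.

WHAT THIS IS NOT: not NS, not E — one more stratum of the crux CLASS 19832 on the MODEL lattice (`--supports` stmt-19832); class-rate DSS members and the slow
DSS window `[2/5, 1/(2+ρ))` are untouched; 19832 OPEN. [folklore; cf. BronziShvydkoy2015 Thm 1.1, ChaeWolf2020 Cor. 1.5]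
-/

noncomputable section

-- flat `Theorems/<Route><Decl>…` files of one crux share the namespace of the crux (tree convention: `Summit.<S>.<S>.…`)
set_option linter.dupNamespace false

open MeasureTheory Set Filter Topology Metric Function TopologicalSpace
open scoped ENNReal NNReal

namespace Summit.NavierStokesRegularity.NavierStokesRegularity.Theorems.PowerGaugeEulerLiouville

open Literature.Analysis Literature.Analysis.FunctionSpaces Literature.Analysis.FluidPDE

namespace OffRateDSS

variable {ρ g T : ℝ}
  {u : ℝ → EuclideanSpace ℝ (Fin 3) → EuclideanSpace ℝ (Fin 3)} {p : ℝ → EuclideanSpace ℝ (Fin 3) → ℝ}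
  {H : ℝ → EuclideanSpace ℝ (Fin 3) → EuclideanSpace ℝ (Fin 3) →L[ℝ] EuclideanSpace ℝ (Fin 3)} {c : ℝ≥0}

/-- **A rate-`g` discrete clock is DSS for the fictitious class `ρ' = 1/g − 2`** (`T > 1`, `g > 0`): with `l = T^{g}` one has `l > 1`,
`l^{1+ρ'} = T^{1−g}`, `l^{2+ρ'} = T`, so `u τ y = T^{1−g} • u (T τ) (T^{g} • y)` reads `u τ y = l^{1+ρ'} • u (l^{2+ρ'} τ) (l • y)`. [folklore] -/
theorem dss_of_discreteClock (hT : 1 < T) (hg0 : 0 < g)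
    (hdss : ∀ τ : ℝ, τ < 0 → ∀ y, u τ y = (T ^ (1 - g)) • u (T * τ) (T ^ g • y)) :
    1 < T ^ g ∧ ∀ τ : ℝ, τ < 0 → ∀ y,
      u τ y = ((T ^ g) ^ (1 + (1 / g - 2))) • u (((T ^ g) ^ (2 + (1 / g - 2))) * τ) ((T ^ g) • y) := by
  have hT0 : 0 < T := lt_trans one_pos hT
  have hgne : g ≠ 0 := hg0.ne'
  have h1 : (T ^ g) ^ (1 + (1 / g - 2)) = T ^ (1 - g) := by
    rw [← Real.rpow_mul hT0.le]
    congr 1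
    field_simp
    ring
  have h2 : (T ^ g) ^ (2 + (1 / g - 2)) = T := by
    rw [← Real.rpow_mul hT0.le, show (2 : ℝ) + (1 / g - 2) = 1 / g by ring, mul_one_div_cancel hgne, Real.rpow_one]
  refine ⟨Real.one_lt_rpow hT hg0, fun τ hτ y => ?_⟩
  rw [h1, h2]
  exact hdss τ hτ y

/-- **The `ρ`-class `A`-gauge makes every slice SUB-EXTREMAL in a smaller normalisation** (`ρ' < ρ`; continuous slice): for `τ₀ < 0`,
`∀ ε > 0, ∀ R̄, ∃ R ≥ R̄, R^{2ρ'−1}∫_{B_R}|u(τ₀)|² ≤ ε`. [folklore] -/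
theorem subExtremal_fictitious_of_gaugeA {ρ' : ℝ} (hρ'ρ : ρ' < ρ)
    (hA : ∀ a : ℝ, 0 < a → ENNReal.ofReal (a ^ (2 * ρ)) * cknA a (0 : ℝ × EuclideanSpace ℝ (Fin 3)) u ≤ (c : ℝ≥0∞))
    {τ₀ : ℝ} (hτ₀ : τ₀ < 0) (hcont : Continuous (u τ₀)) :
    ∀ ε : ℝ, 0 < ε → ∀ Rbar : ℝ, ∃ R : ℝ, Rbar ≤ R ∧
      R ^ (2 * ρ' - 1) * ∫ x in ball (0 : EuclideanSpace ℝ (Fin 3)) R, ‖u τ₀ x‖ ^ 2 ≤ ε := by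
  intro ε hε Rbar
  have hc0 : (0 : ℝ) ≤ c := c.2
  -- `c R^{2(ρ'−ρ)} → 0`
  have htend : Tendsto (fun R : ℝ => (c : ℝ) * R ^ (2 * (ρ' - ρ))) atTop (𝓝 ((c : ℝ) * 0)) := by
    refine tendsto_const_nhds.mul ?_
    have := tendsto_rpow_neg_atTop (y := -(2 * (ρ' - ρ))) (by linarith)
    simpa using this
  rw [mul_zero] at htend
  obtain ⟨R, hRε, hRge⟩ := ((htend.eventually (ge_mem_nhds hε)).and
    (eventually_ge_atTop (max Rbar (Real.sqrt (-τ₀) + 1)))).exists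
  have hRbar : Rbar ≤ R := (le_max_left _ _).trans hRge
  have hRs : Real.sqrt (-τ₀) + 1 ≤ R := (le_max_right _ _).trans hRge
  have hR0 : 0 < R := by linarith [Real.sqrt_nonneg (-τ₀)]
  refine ⟨R, hRbar, ?_⟩
  -- the slice bound `∫_{B_R}|u(τ₀)|² ≤ c R^{1−2ρ}` from the `A`-gauge (`τ₀ ∈ (−R², 0)`)
  have hs : τ₀ ∈ Ioo (-(R ^ 2)) 0 := by
    refine ⟨?_, hτ₀⟩
    have h1 : Real.sqrt (-τ₀) < R := by linarith
    have h2 : -τ₀ < R ^ 2 := by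
      have := Real.sqrt_lt' hR0 |>.1 h1
      linarith
    linarith
  have hlin := Backward.lintegral_ball_le_of_gaugeA hR0 (hA R hR0) hs
  have hint : IntegrableOn (fun x => ‖u τ₀ x‖ ^ 2) (ball (0 : EuclideanSpace ℝ (Fin 3)) R) volume :=
    ((hcont.norm.pow 2).continuousOn.integrableOn_compact (isCompact_closedBall (0 : EuclideanSpace ℝ (Fin 3)) R)).mono_set
      ball_subset_closedBall
  have hreal : ∫ x in ball (0 : EuclideanSpace ℝ (Fin 3)) R, ‖u τ₀ x‖ ^ 2 ≤ (c : ℝ) * R ^ (1 - 2 * ρ) := by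
    rw [integral_eq_lintegral_of_nonneg_ae (Eventually.of_forall fun x => sq_nonneg _) hint.aestronglyMeasurable]
    have e : ∫⁻ x in ball (0 : EuclideanSpace ℝ (Fin 3)) R, ENNReal.ofReal (‖u τ₀ x‖ ^ 2) =
        ∫⁻ x in ball (0 : EuclideanSpace ℝ (Fin 3)) R, ‖u τ₀ x‖ₑ ^ 2 :=
      lintegral_congr fun x => by rw [← ofReal_norm, ENNReal.ofReal_pow (norm_nonneg _)]
    rw [e]
    have := ENNReal.toReal_mono ENNReal.ofReal_ne_top hlin
    rwa [ENNReal.toReal_ofReal (by positivity)] at this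
  calc R ^ (2 * ρ' - 1) * ∫ x in ball (0 : EuclideanSpace ℝ (Fin 3)) R, ‖u τ₀ x‖ ^ 2
      ≤ R ^ (2 * ρ' - 1) * ((c : ℝ) * R ^ (1 - 2 * ρ)) := mul_le_mul_of_nonneg_left hreal (Real.rpow_nonneg hR0.le _)
    _ = (c : ℝ) * R ^ (2 * (ρ' - ρ)) := by
        rw [show (c : ℝ) * R ^ (2 * (ρ' - ρ)) = (c : ℝ) * (R ^ (2 * ρ' - 1) * R ^ (1 - 2 * ρ)) by
          rw [← Real.rpow_add hR0]; ring_nf]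
        ring
    _ ≤ ε := hRε

/-- **OFF-RATE CLASSICAL DSS MEMBERS IN THE WINDOW ARE TRIVIAL.**  Crux hypotheses verbatim (`0 < ρ ≤ ½`, weak class) + `(u, p)` classical on the open past +
a DISCRETE CLOCK at a rate `g ∈ (1/(2+ρ), ½)` — `u τ y = T^{1−g} • u (T τ) (T^{g} • y)` for all `τ < 0`, one factor `T > 1` — + the Bernoulli shell bound
`∫_{R≤|y|≤2R} (|u(τ)|³ + 2|p(τ)||u(τ)|) ≤ K R^β` for `R ≥ R₀(−τ)^{γ'}` (`β < 1`) ⇒ `u = 0` a.e. on `(−∞,0) × ℝ³`.  NO sub-extremality hypothesis: in the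
fictitious class `ρ' = 1/g − 2 < ρ` it is automatic (`subExtremal_fictitious_of_gaugeA`), and ns-typeII-p3's `CollapseEnergy.eq_zero_of_dss_subExtremal` at
`ρ'` concludes. [folklore; cf. BronziShvydkoy2015 Thm 1.1] -/
theorem ae_eq_zero_of_gauge_of_classical_dss_window (hρ : 0 < ρ) (hρh : ρ ≤ 1 / 2)
    (hsw : IsSuitableWeakSolutionOn (slab (EuclideanSpace ℝ (Fin 3)) (Iio 0) isOpen_Iio) 0 0 u p)
    (hH : HasWeakSpatialGradientOn (slab (EuclideanSpace ℝ (Fin 3)) (Iio 0) isOpen_Iio) u H)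
    (hgauge : ∀ a : ℝ, 0 < a →
      ENNReal.ofReal (a ^ (2 * ρ)) * cknA a (0 : ℝ × EuclideanSpace ℝ (Fin 3)) u +
          ENNReal.ofReal (a ^ ρ) * cknE a (0 : ℝ × EuclideanSpace ℝ (Fin 3)) H +
        ENNReal.ofReal (a ^ (2 * ρ)) * cknD a (0 : ℝ × EuclideanSpace ℝ (Fin 3)) p ≤ (c : ℝ≥0∞))
    (hns : IsClassicalNSSolutionOn (Iio 0) 0 0 u p)
    (hT : 1 < T) (hg1 : 1 / (2 + ρ) < g) (hg2 : g < 1 / 2)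
    (hdss : ∀ τ : ℝ, τ < 0 → ∀ y, u τ y = (T ^ (1 - g)) • u (T * τ) (T ^ g • y))
    {K R₀ γ' β : ℝ} (hK : 0 ≤ K) (hR₀ : 0 ≤ R₀) (hγ' : 0 ≤ γ') (hβ : β < 1)
    (hshell : ∀ τ : ℝ, τ < 0 → ∀ R : ℝ, 0 < R → R₀ * (-τ) ^ γ' ≤ R →
      ∫ x in {y : EuclideanSpace ℝ (Fin 3) | R ≤ ‖y‖ ∧ ‖y‖ ≤ 2 * R},
        (‖u τ x‖ ^ 3 + 2 * |p τ x| * ‖u τ x‖) ≤ K * R ^ β) :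
    uncurry u =ᵐ[volume.restrict (Iio (0 : ℝ) ×ˢ (univ : Set (EuclideanSpace ℝ (Fin 3))))] 0 := by
  have _h := hsw
  have _h' := hH
  have hρ1 : ρ < 1 := by linarith
  obtain ⟨hρ'0, hρ'ρ, -, -⟩ := OffRate.exponent_facts hρ hρ1 hg1 hg2
  have hρ'h : 1 / g - 2 ≤ 1 / 2 := by linarith
  have h2ρ : (0 : ℝ) < 2 + ρ := by linarith
  have hg0 : 0 < g := lt_trans (one_div_pos.2 h2ρ) hg1
  have hA : ∀ a : ℝ, 0 < a → ENNReal.ofReal (a ^ (2 * ρ)) *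
      cknA a (0 : ℝ × EuclideanSpace ℝ (Fin 3)) u ≤ (c : ℝ≥0∞) :=
    fun a ha => le_trans (le_trans le_self_add le_self_add) (hgauge a ha)
  -- the fictitious-class DSS structure and sub-extremality at `τ₀ = −1`
  obtain ⟨hl, hdss'⟩ := dss_of_discreteClock hT hg0 hdss
  have hcont : Continuous (u (-1)) := (hns.contDiff_velocity (by norm_num : (-1 : ℝ) < 0)).continuous
  have hsub := subExtremal_fictitious_of_gaugeA (u := u) hρ'ρ hA (by norm_num : (-1 : ℝ) < 0) hcont
  have h := CollapseEnergy.eq_zero_of_dss_subExtremal hns hρ'0 hρ'h hl hdss' hK hR₀ hγ' hβ hshell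
    (by norm_num : (-1 : ℝ) < 0) hsub
  refine (ae_restrict_iff' (measurableSet_Iio.prod MeasurableSet.univ)).2 (Eventually.of_forall ?_)
  rintro ⟨τ, y⟩ ⟨hτ, -⟩
  exact h τ hτ y

/-! ### The slow discrete window `g ∈ [2/5, 1/(2+ρ))`: the own-rate census (appended) -/

/-- **OWN-RATE SUB-EXTREMAL SLOW DISCRETE CLOCKS ARE TRIVIAL** (the discrete twin of `SlowClock.selfSimilar_ae_eq_zero_of_ownRate_subExtremal_past`).  Crux
hypotheses verbatim (`0 < ρ ≤ ½`) + `(u, p)` classical on the open past + a discrete clock at ANY rate `g ∈ [2/5, ½)` (`u τ y = T^{1−g} • u (Tτ) (T^{g} • y)`,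
`T > 1`) + the Bernoulli shell bound + OWN-RATE SUB-EXTREMALITY at one time `τ₀ < 0`: `∀ ε > 0, ∀ R̄, ∃ R ≥ R̄, R^{2(1/g−2)−1}∫_{B_R}|u(τ₀)|² ≤ ε` ⇒ `u = 0`
a.e.  (`CollapseEnergy.eq_zero_of_dss_subExtremal` in the fictitious class `ρ' = 1/g − 2 ∈ (0, ½]`; for `g > 1/(2+ρ)` the sub-extremality is automatic,
`ae_eq_zero_of_gauge_of_classical_dss_window`.)  The crux hypotheses are carried for the wiring shape only. [folklore; cf. BronziShvydkoy2015 Thm 1.1] -/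
theorem ae_eq_zero_of_gauge_of_classical_dss_ownRate_subExtremal (hρ : 0 < ρ) (hρh : ρ ≤ 1 / 2)
    (hsw : IsSuitableWeakSolutionOn (slab (EuclideanSpace ℝ (Fin 3)) (Iio 0) isOpen_Iio) 0 0 u p)
    (hH : HasWeakSpatialGradientOn (slab (EuclideanSpace ℝ (Fin 3)) (Iio 0) isOpen_Iio) u H)
    (hgauge : ∀ a : ℝ, 0 < a →
      ENNReal.ofReal (a ^ (2 * ρ)) * cknA a (0 : ℝ × EuclideanSpace ℝ (Fin 3)) u +
          ENNReal.ofReal (a ^ ρ) * cknE a (0 : ℝ × EuclideanSpace ℝ (Fin 3)) H +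
        ENNReal.ofReal (a ^ (2 * ρ)) * cknD a (0 : ℝ × EuclideanSpace ℝ (Fin 3)) p ≤ (c : ℝ≥0∞))
    (hns : IsClassicalNSSolutionOn (Iio 0) 0 0 u p)
    (hT : 1 < T) (hg25 : 2 / 5 ≤ g) (hg2 : g < 1 / 2)
    (hdss : ∀ τ : ℝ, τ < 0 → ∀ y, u τ y = (T ^ (1 - g)) • u (T * τ) (T ^ g • y))
    {K R₀ γ' β : ℝ} (hK : 0 ≤ K) (hR₀ : 0 ≤ R₀) (hγ' : 0 ≤ γ') (hβ : β < 1)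
    (hshell : ∀ τ : ℝ, τ < 0 → ∀ R : ℝ, 0 < R → R₀ * (-τ) ^ γ' ≤ R →
      ∫ x in {y : EuclideanSpace ℝ (Fin 3) | R ≤ ‖y‖ ∧ ‖y‖ ≤ 2 * R},
        (‖u τ x‖ ^ 3 + 2 * |p τ x| * ‖u τ x‖) ≤ K * R ^ β)
    {τ₀ : ℝ} (hτ₀ : τ₀ < 0)
    (hsub : ∀ ε : ℝ, 0 < ε → ∀ Rbar : ℝ, ∃ R : ℝ, Rbar ≤ R ∧
      R ^ (2 * (1 / g - 2) - 1) * ∫ x in ball (0 : EuclideanSpace ℝ (Fin 3)) R, ‖u τ₀ x‖ ^ 2 ≤ ε) :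
    uncurry u =ᵐ[volume.restrict (Iio (0 : ℝ) ×ˢ (univ : Set (EuclideanSpace ℝ (Fin 3))))] 0 := by
  have _h1 := hsw
  have _h2 := hH
  have _h3 := hgauge
  have _h4 := hρh
  have _h5 := hρ
  have hg0 : 0 < g := by linarith
  have hρ'0 : 0 < 1 / g - 2 := by
    rw [sub_pos, lt_div_iff₀ hg0]; linarith
  have hρ'h : 1 / g - 2 ≤ 1 / 2 := by
    rw [sub_le_iff_le_add, div_le_iff₀ hg0]; linarith
  obtain ⟨hl, hdss'⟩ := dss_of_discreteClock hT hg0 hdss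
  have h := CollapseEnergy.eq_zero_of_dss_subExtremal hns hρ'0 hρ'h hl hdss' hK hR₀ hγ' hβ hshell hτ₀ hsub
  refine (ae_restrict_iff' (measurableSet_Iio.prod MeasurableSet.univ)).2 (Eventually.of_forall ?_)
  rintro ⟨τ, y⟩ ⟨hτ, -⟩
  exact h τ hτ y

/-- **SLOW DISCRETE CLOCKS SATURATE THEIR OWN RATE** (the discrete twin of the own-rate two-sided law): a NONTRIVIAL classical discrete clock of rate
`g ∈ [2/5, ½)` with the Bernoulli shell bound has, at every time `τ₀ < 0`, `∫_{B_R}|u(τ₀)|² ≥ c₁ R^{5 − 2/g}` for all large `R` (`c₁ > 0`) —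
`CollapseEnergy.dss_energy_saturation` in the fictitious class `ρ' = 1/g − 2` (`1 − 2ρ' = 5 − 2/g`). [folklore; cf. BronziShvydkoy2015 Thm 1.1] -/
theorem dss_ownRate_energy_saturation (hns : IsClassicalNSSolutionOn (Iio 0) 0 0 u p)
    (hT : 1 < T) (hg25 : 2 / 5 ≤ g) (hg2 : g < 1 / 2)
    (hdss : ∀ τ : ℝ, τ < 0 → ∀ y, u τ y = (T ^ (1 - g)) • u (T * τ) (T ^ g • y))
    {K R₀ γ' β : ℝ} (hK : 0 ≤ K) (hR₀ : 0 ≤ R₀) (hγ' : 0 ≤ γ') (hβ : β < 1)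
    (hshell : ∀ τ : ℝ, τ < 0 → ∀ R : ℝ, 0 < R → R₀ * (-τ) ^ γ' ≤ R →
      ∫ x in {y : EuclideanSpace ℝ (Fin 3) | R ≤ ‖y‖ ∧ ‖y‖ ≤ 2 * R},
        (‖u τ x‖ ^ 3 + 2 * |p τ x| * ‖u τ x‖) ≤ K * R ^ β)
    (hne : ∃ τ : ℝ, τ < 0 ∧ ∃ y, u τ y ≠ 0) {τ₀ : ℝ} (hτ₀ : τ₀ < 0) :
    ∃ c₁ : ℝ, 0 < c₁ ∧ ∃ R₁ : ℝ, ∀ R : ℝ, R₁ ≤ R →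
      c₁ * R ^ (5 - 2 / g) ≤ ∫ x in ball (0 : EuclideanSpace ℝ (Fin 3)) R, ‖u τ₀ x‖ ^ 2 := by
  have hg0 : 0 < g := by linarith
  have hρ'0 : 0 < 1 / g - 2 := by
    rw [sub_pos, lt_div_iff₀ hg0]; linarith
  have hρ'h : 1 / g - 2 ≤ 1 / 2 := by
    rw [sub_le_iff_le_add, div_le_iff₀ hg0]; linarith
  obtain ⟨hl, hdss'⟩ := dss_of_discreteClock hT hg0 hdss
  obtain ⟨c₁, hc₁, R₁, hR₁⟩ := CollapseEnergy.dss_energy_saturation hns hρ'0 hρ'h hl hdss' hK hR₀ hγ' hβ hshell hne hτ₀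
  refine ⟨c₁, hc₁, R₁, fun R hR => ?_⟩
  have := hR₁ R hR
  rwa [show (1 : ℝ) - 2 * (1 / g - 2) = 5 - 2 / g by ring] at this

end OffRateDSS

end Summit.NavierStokesRegularity.NavierStokesRegularity.Theorems.PowerGaugeEulerLiouville

end
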